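import Literature.NumberTheory.Automorphic.WhittakerTowerBottom
import Literature.NumberTheory.Automorphic.GlobalWhittakerCoefficient
import HarnessLib

/-!
# The Whittaker tower, V: `Φ_0` is the global Whittaker coefficient

Topic `NumberTheory/Automorphic`; namespace `Literature.NumberTheory.Automorphic`. The bottom of the
Whittaker tower `Φ_0 = whittakerDepth 0 φ` (iterated normalised column transforms against Tate's
character `ψ = adeleAddChar K`) coincides with the **global `ψ`-Whittaker coefficient** of
`GlobalWhittakerCoefficient` computed with any Haar measure `ν₀` of `N_n(𝔸_K)` on Tate's box `𝓕_N`
(`unipotentTateDomain`):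

  `whittakerDepth 0 φ g = whittakerCoeff ν₀ 𝓕_N ψ φ g`   (`whittakerDepth_zero_eq_whittakerCoeff`,
  `φ` continuous, `1 ≤ n`),

so that the tree's results on `whittakerCoeff` (Shintani's formula for smoothed cusp forms,
`WhittakerCoeffCuspidal`) apply to `Φ_0`. Ingredients: the topological group isomorphism
`U_{[1,n-1]}(𝔸_K) ≅ N_n(𝔸_K)` (`colRangeEquivUnipotent`, the two subgroups of `GL_n(𝔸_K)` coincide),
which maps the box onto `𝓕_N` and transports Haar measures; `superdiagSum = superdiagSumFrom 1`; and
the closed formula `whittakerIter_eq_boxIntegral`. Everything is proved.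

## References

* J. W. Cogdell, *Analytic theory of L-functions for GL_n*, in *An Introduction to the Langlands
  Program* (2004), §1.1 [CogdellAnalyticTheory2004].
-/

noncomputable section

open MeasureTheory Measure NumberField IsDedekindDomain Matrix Set Filter Topology
open scoped MatrixGroups ENNReal NNReal ComplexConjugate

namespace Literature.NumberTheory.Automorphic

section Coeff

variable {n : ℕ} {K : Type} [Field K] [NumberField K]

/-- `U_{[1,n-1]} = N_n` as subgroups of `GL_n` (the column `0` carries no entries above the diagonal).
[folklore] -/
theorem unipotentColRange_one_eq_upperUnitriangular {R : Type*} [CommRing R] :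
    unipotentColRange n R 1 (n - 1) = upperUnitriangular (Fin n) R := by
  rw [← unipotentColRange_zero_eq, unipotentColRange_eq_upperUnitriangular (by omega)]

/-- **`U_{[1,n-1]}(𝔸_K) ≅ N_n(𝔸_K)`** as topological groups (the identity on matrices). [folklore] -/
def colRangeEquivUnipotent : ↥(adelicColRange n K 1 (n - 1)) ≃ₜ* ↥(adelicUnipotent n K) where
  toFun u := toAdelicUnipotent u
  invFun u := ⟨u, (SetLike.ext_iff.mp (unipotentColRange_one_eq_upperUnitriangular (n := n)
    (R := AdeleRing (𝓞 K) K)) (u : GL (Fin n) (AdeleRing (𝓞 K) K))).2 u.2⟩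
  left_inv _ := Subtype.ext rfl
  right_inv _ := Subtype.ext rfl
  map_mul' _ _ := Subtype.ext rfl
  continuous_toFun := Continuous.subtype_mk continuous_subtype_val _
  continuous_invFun := Continuous.subtype_mk continuous_subtype_val _

/-- The underlying matrix is unchanged (definitional). [folklore] -/
@[simp]
theorem coe_colRangeEquivUnipotent (u : ↥(adelicColRange n K 1 (n - 1))) :
    ((colRangeEquivUnipotent (n := n) (K := K) u : ↥(adelicUnipotent n K)) : GL (Fin n) (AdeleRing (𝓞 K) K)) = u := rfl

/-- The underlying matrix of the inverse is unchanged (definitional). [folklore] -/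
@[simp]
theorem coe_colRangeEquivUnipotent_symm (u : ↥(adelicUnipotent n K)) :
    (((colRangeEquivUnipotent (n := n) (K := K)).symm u : ↥(adelicColRange n K 1 (n - 1))) :
      GL (Fin n) (AdeleRing (𝓞 K) K)) = u := rfl

/-- **The box goes to Tate's box `𝓕_N`** (same entrywise condition). [folklore] -/
theorem image_colRangeEquivUnipotent_box :
    colRangeEquivUnipotent (n := n) (K := K) '' colRangeTateDomain n K 1 (n - 1) = unipotentTateDomain n K := by
  ext u
  constructor
  · rintro ⟨v, hv, rfl⟩
    exact fun i j hij => hv i j hij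
  · intro hu
    exact ⟨(colRangeEquivUnipotent (n := n) (K := K)).symm u, fun i j hij => hu i j hij,
      (colRangeEquivUnipotent (n := n) (K := K)).apply_symm_apply u⟩

/-- The preimage form. [folklore] -/
theorem preimage_colRangeEquivUnipotent_symm_box :
    (colRangeEquivUnipotent (n := n) (K := K)).symm ⁻¹' colRangeTateDomain n K 1 (n - 1) = unipotentTateDomain n K := by
  rw [← image_colRangeEquivUnipotent_box]
  exact ((colRangeEquivUnipotent (n := n) (K := K)).toEquiv.image_eq_preimage_symm _).symm

/-- **`superdiagSum = superdiagSumFrom 1`**: `Σ_i Σ_j [i+1 = j] u_{ij} = Σ_{j ≥ 1} u_{j-1,j}`. [folklore] -/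
theorem superdiagSum_eq_superdiagSumFrom_one {R : Type*} [CommRing R] (u : ↥(upperUnitriangular (Fin n) R)) :
    superdiagSum u = superdiagSumFrom 1 (((u : GL (Fin n) R)) : Matrix (Fin n) (Fin n) R) := by
  classical
  rw [superdiagSum_def, Finset.sum_comm]
  unfold superdiagSumFrom
  refine Finset.sum_congr rfl fun j _ => ?_
  by_cases hj : 1 ≤ (j : ℕ) ∧ 0 < (j : ℕ)
  · rw [dif_pos hj, Finset.sum_eq_single (⟨(j : ℕ) - 1, by have := j.2; omega⟩ : Fin n)]
    · rw [if_pos (by simp; omega)]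
    · intro i _ hi
      rw [if_neg]
      intro h
      apply hi
      exact Fin.ext (by simp; omega)
    · intro h; exact (h (Finset.mem_univ _)).elim
  · rw [dif_neg hj]
    refine Finset.sum_eq_zero fun i _ => ?_
    rw [if_neg]
    intro h
    apply hj
    omega

variable [MeasurableSpace (GL (Fin n) (AdeleRing (𝓞 K) K))] [BorelSpace (GL (Fin n) (AdeleRing (𝓞 K) K))]

/-- **`Φ_0` is the global Whittaker coefficient.** For `φ` continuous, `1 ≤ n`, every Haar measure
`ν₀` of `N_n(𝔸_K)` and every `g`:
`whittakerDepth 0 φ g = whittakerCoeff ν₀ 𝓕_N ψ φ g` with `𝓕_N` Tate's box and `ψ = adeleAddChar K`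
(closed formula `whittakerIter_eq_boxIntegral` at `k = n - 1`, transported along
`colRangeEquivUnipotent`). [folklore] -/
theorem whittakerDepth_zero_eq_whittakerCoeff {φ : GL (Fin n) (AdeleRing (𝓞 K) K) → ℂ} (hφ : Continuous φ)
    (hn : 1 ≤ n) (ν₀ : Measure ↥(adelicUnipotent n K)) [IsHaarMeasure ν₀]
    (g : GL (Fin n) (AdeleRing (𝓞 K) K)) :
    whittakerDepth 0 φ g = whittakerCoeff ν₀ (unipotentTateDomain n K) (adeleAddChar K) φ g := by
  set e := colRangeEquivUnipotent (n := n) (K := K) with he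
  -- the transported Haar measure
  set ν : Measure ↥(adelicColRange n K 1 (n - 1)) := ν₀.map e.symm with hν
  haveI : IsHaarMeasure ν := e.symm.isHaarMeasure_map ν₀
  have hme : MeasurableEmbedding e.symm := e.symm.toHomeomorph.toMeasurableEquiv.measurableEmbedding
  -- the closed formula at `k = n - 1`
  have hk : n - (n - 1) = 1 := by omega
  have hclosed := whittakerIter_eq_boxIntegral (K := K) hφ (n - 1) (by omega)
  rw [hk] at hclosed
  have h1 := hclosed ν g
  unfold whittakerDepth
  rw [show n - 1 - 0 = n - 1 from rfl, h1, whittakerCoeff_def]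
  -- the box volume
  have hvol : ν (colRangeTateDomain n K 1 (n - 1)) = ν₀ (unipotentTateDomain n K) := by
    rw [hν, Measure.map_apply hme.measurable measurableSet_colRangeTateDomain, he,
      preimage_colRangeEquivUnipotent_symm_box]
  rw [hvol]
  congr 1
  -- the integral
  rw [hν, hme.setIntegral_map, preimage_colRangeEquivUnipotent_symm_box]
  refine setIntegral_congr_fun measurableSet_unipotentTateDomain fun u _ => ?_
  rw [coe_colRangeEquivUnipotent_symm, whittakerCharFun_apply, superdiagSum_eq_superdiagSumFrom_one, unipotentCharFrom_apply]

end Coeff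

end Literature.NumberTheory.Automorphic
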